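import Literature.NumberTheory.Automorphic.SplitOrthogonalSatakeCountingImage
import Literature.NumberTheory.Automorphic.HyperspecialUnitarySatakeOrbitSumBasis
import HarnessLib

/-!
# The split orthogonal group `O_N(J₀)`: parity of the twisted exponents, the orbit-sum basis
# `S^{O}_λ = ∑_{μ ∈ Wλ} q^{(Λ(μ)-Λ(λ))/2} x^μ` of `𝒮_1(ℋ(O_N(J₀), K₀; R))` over every commutative ring `R`, and the
# mod-`p` image for `N` odd (Treumann–Venkatesh §7.2; Henniart–Vignéras §7.12–§7.15; Herzig Thm. 1.2)

Topic `NumberTheory/Automorphic`; namespace `Literature.NumberTheory.Automorphic.HermitianLattice[.UnramifiedLocalConjDatum]`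
(lane `lit-hodgefound`, Track 2 foundations; seat `lit-hodgefound-p11`, generation 49, row g49-#10).  One DEFINITION with body
(`orthogonalTwistedOrbitSum R N q λ`) + theorems; no named fact, no instance, no notation.  Completes g49-#9
(`SplitOrthogonalSatakeCountingImage`: `𝒮_1(ℋ_R) = 𝒯^{O}_R(q)` for `O_N(J₀)`, relations `f_{μ∘π} = q^{⌊(Λ(μ∘π)-Λ(μ))/2⌋} f_μ`) in
the way g49-#7/#8 complete g49-#6 for `U(σ, J₀)`.

## The mathematics and the print

`G = O_N(J₀) = U(id, J₀^{(N)})`, `W = C_{S_N}(rev)`, `Λ(μ) = ⟨ν,μ⟩ - hs(μ)` (`orthogonalTwistExp`), `Λ⁻ = Λ^{--}` the monotone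
antisymmetric cocharacters (one in each `W`-orbit of antisymmetric cocharacters, g49-#8 `eq_of_monotone_of_mem_weylOrbitRev`).

§1 PARITY ([TreumannVenkatesh2016] §7.2: «Note that `Σ^*/wΣ^*_G` is divisible by `2` in that cocharacter lattice; thus
`√(Σ^*_G/wΣ^*_G)(q_v)` makes sense»; [HenniartVigneras2013] §7.12 Lemma 2: `δ(λ/w(λ)) = ∏_{b>0, w(b)<0} δ_b(z)²`): for
antisymmetric `μ` and `π ∈ W`, `Λ(μ∘π) - Λ(μ)` is EVEN.  Proof: `⟨ν,μ∘π⟩ - ⟨ν,μ⟩ = ∑_j (j - π⁻¹j) μ_j` whose summand is `rev`-even,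
hence twice its first-block sum; and `2(hs(μ∘π) - hs(μ)) = ∑_j (s(π⁻¹ j) - s(j)) μ_j` for the `rev`-odd sign vector
`s = 𝟙_{[0,h)} - 𝟙_{rev [0,h)}`, again `rev`-even, with first-block coefficients `s(π⁻¹j) - 1 ∈ {0, -2}`.
§2 `Λ` IS MINIMAL ON EACH `W`-ORBIT AT ITS ANTIDOMINANT ELEMENT ([HenniartVigneras2013] §7.16 «`A(w(λ)) ≥ A(λ)`», [Bourbaki] VI §1
no 6 Prop. 18 for the twisted length): `Λ(λ) ≤ Λ(μ)` for `μ ∈ Wλ`, `λ ∈ Λ⁻` — the head-sum-lexicographic minimum of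
`{ν ∈ Wλ : Λ(ν) ≤ Λ(μ)}` is antidominant (g49-#9 `monotone_of_isMinOn_headSumVec_orthogonal`), hence is `λ`; for `N` ODD the minimum
is attained only at `λ` (every correcting move lowers `Λ` strictly), for `N` even also at the flip of the last first-block coordinate.
§3–§4 THE ORBIT-SUM BASIS ([HenniartVigneras2013] §7.13 Thm./Prop./Cor., §7.15 Thm.: «the family `1_C ⊗ S_λ`, `λ` in `Λ⁻`, is a
basis of its image»): `S^{O}_λ = ∑_{μ ∈ Wλ} q^{(Λ(μ)-Λ(λ))/2} x^μ ∈ 𝒯^{O}_R(q)` (§1–§2 make the exponents natural numbers adding up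
correctly), every `f ∈ 𝒯^{O}_R` equals `∑_{λ ∈ Λ⁻} f_λ S^{O}_λ`, the `S^{O}_λ` are linearly independent, so form an `R`-basis of
`𝒯^{O}_R(b)` for every `R` and `b`, and — through g49-#9's `countingSatakeLinearEquivOrthogonal` — `ℋ(O_N(J₀), K₀; R)` is free with a basis
mapped by `𝒮_1` onto the `S^{O}_λ`.
§5 THE MOD-`p` IMAGE FOR `N` ODD ([Herzig2010] Thm. 1.2, [HenniartVigneras2013] Thm. 1.5 (ii): «Its image is the space of functions
supported on antidominant elements»): if `q = 0` in `R` and `N` is odd, `𝒯^{O}_R(q)` = the functions supported on `Λ⁻`, hence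
`f ∈ 𝒮_1(ℋ(O_N(J₀), K₀; R))` iff every exponent of `f` is antidominant antisymmetric (for `N` even the flip of the last first-block
coordinate has twist exponent `0`, and the image consists instead of the functions supported on the `Λ`-minimal elements and constant
on them within each orbit — not formalised here).

## What is formalised

* §1 `rev_eq_self_iff`, `sum_eq_two_mul_sum_ite_of_rev`, `satakeTwistExp_comp_perm_sub`, `two_dvd_satakeTwistExp_comp_sub`,
  `two_dvd_headSum_comp_sub`, **`two_dvd_orthogonalTwistExp_comp_sub`**.
* §2 `monotone_of_forall_le_of_rev`, `satakeTwistExp_comp_swapPairs_lt`, `orthogonalTwistExp_comp_swapPairs_lt`,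
  `orthogonalTwistExp_comp_flipPair_lt`, **`orthogonalTwistExp_le_of_mem_weylOrbitRev`**, `two_dvd_orthogonalTwistExp_sub_of_mem_weylOrbitRev`,
  **`eq_of_orthogonalTwistExp_le_of_mem_weylOrbitRev_odd`**.
* §3 `orthogonalTwistedOrbitSum` (+ `coeff_…`, `_self`, `_eq_zero_of_monotone`), **`orthogonalTwistedOrbitSum_mem_orthogonalTwistedSatakeTarget`**,
  `orthogonalTwistedOrbitSum_of_cast_eq_zero_odd`.
* §4 `exists_monotone_coeff_ne_zero_of_mem_orthogonalTwisted`, **`eq_sum_coeff_smul_orthogonalTwistedOrbitSum_of_mem`**,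
  **`linearIndependent_orthogonalTwistedOrbitSum`**, **`exists_basis_orthogonalTwistedSatakeTarget`**; with `hd`:
  `orthogonalTwistedOrbitSum_mem_range_satakeTransform_one`, **`exists_basis_range_satakeTransform_one_orthogonal`**,
  **`exists_basis_heckeAlgebra_satakeTransform_one_eq_orthogonalTwistedOrbitSum`**.
* §5 **`mem_orthogonalTwistedSatakeTarget_iff_of_cast_eq_zero_odd`**, `natCast_card_residueField_eq_zero_of_charP`,
  `monotone_of_coeff_satakeTransform_one_ne_zero_orthogonal_odd`, **`mem_range_satakeTransform_one_iff_of_cast_eq_zero_orthogonal_odd`**,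
  `mem_range_satakeTransform_one_iff_of_charP_orthogonal_odd`.

## References
* [TreumannVenkatesh2016] D. Treumann, A. Venkatesh, *Functoriality, Smith theory, and the Brauer homomorphism*, Ann. of Math. 183
  (2016), §7.2.
* [HenniartVigneras2013] G. Henniart, M.-F. Vignéras, *A Satake isomorphism for representations modulo p of reductive groups over
  local fields*, J. reine angew. Math. 701 (2015), Thm. 1.5, §7.12 Lemma 2, §7.13–§7.16.
* [Herzig2010] F. Herzig, *A Satake isomorphism in characteristic p*, Compositio Math. 147 (2011), Thm. 1.2, §1.2.
* [ZhuIntegralSatake2020] X. Zhu, *A note on integral Satake isomorphisms*, arXiv:2005.13056, §1.3 Lemma 8.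
* [BruhatTits1972] F. Bruhat, J. Tits, *Groupes réductifs sur un corps local I*, Publ. Math. IHÉS 41 (1972), (4.4.3), (4.4.4).
-/

noncomputable section

open scoped Valued WithZero Matrix MatrixGroups
open MonoidAlgebra Representation

namespace Literature.NumberTheory.Automorphic.HermitianLattice

open Literature.NumberTheory.Automorphic Literature.NumberTheory.Automorphic.CartanUnique
  Literature.NumberTheory.Automorphic.SymplecticCartan

variable {R : Type*} [CommRing R] {N : ℕ}

/-! ## §1 Parity: `Λ(μ∘π) ≡ Λ(μ) (mod 2)` -/

section Parity

/-- `rev i = i` iff `i` is the middle index (`2i + 1 = N`). [cite: BruhatTits1972, (4.4.3)] -/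
theorem rev_eq_self_iff (i : Fin N) : Fin.rev i = i ↔ 2 * (i : ℕ) + 1 = N := by
  rw [Fin.ext_iff, Fin.val_rev]; have := i.isLt; omega

/-- **Pairing lemma**: a `rev`-even function vanishing at the `rev`-fixed point sums to twice its first-block sum.
[cite: BruhatTits1972, (4.4.3)] -/
theorem sum_eq_two_mul_sum_ite_of_rev {p : Fin N → ℤ} (hp : ∀ j, p (Fin.rev j) = p j) (hp0 : ∀ j, Fin.rev j = j → p j = 0) :
    ∑ j, p j = 2 * ∑ j : Fin N, if (j : ℕ) < N / 2 then p j else 0 := by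
  have h1 : ∑ j : Fin N, p j = ∑ j : Fin N, ((if (j : ℕ) < N / 2 then p j else 0) + if ¬ (j : ℕ) < N / 2 then p j else 0) :=
    Finset.sum_congr rfl fun j _ => by split_ifs <;> simp
  have h2 : ∑ j : Fin N, (if ¬ (j : ℕ) < N / 2 then p j else 0) =
      ∑ j : Fin N, (if ¬ ((Fin.rev j : Fin N) : ℕ) < N / 2 then p j else 0) := by
    rw [← Equiv.sum_comp Fin.revPerm (fun j : Fin N => if ¬ (j : ℕ) < N / 2 then p j else 0)]
    exact Finset.sum_congr rfl fun j _ => by rw [Fin.revPerm_apply, hp]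
  have h3 : ∀ j : Fin N, (if ¬ ((Fin.rev j : Fin N) : ℕ) < N / 2 then p j else 0) = if (j : ℕ) < N / 2 then p j else 0 := by
    intro j
    have hj := j.isLt
    by_cases hmid : Fin.rev j = j
    · rw [hp0 j hmid]; split_ifs <;> rfl
    · rw [rev_eq_self_iff] at hmid
      have : (¬ ((Fin.rev j : Fin N) : ℕ) < N / 2) ↔ (j : ℕ) < N / 2 := by rw [Fin.val_rev]; omega
      simp only [this]
  rw [h1, Finset.sum_add_distrib, h2, Finset.sum_congr rfl fun j _ => h3 j, two_mul]

/-- `⟨ν, μ∘π⟩ - ⟨ν, μ⟩ = ∑_j (j - π⁻¹ j) μ_j` for every `μ` and every coordinate permutation `π`. [cite: BruhatTits1972, (4.4.3)] -/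
theorem satakeTwistExp_comp_perm_sub (μ : Fin N → ℤ) (π : Equiv.Perm (Fin N)) :
    satakeTwistExp (μ ∘ π) - satakeTwistExp μ = ∑ j : Fin N, (((j : ℕ) : ℤ) - ((π⁻¹ j : Fin N) : ℕ)) * μ j := by
  have h1 : satakeTwistExp (μ ∘ ⇑π) = ∑ j : Fin N, ((N : ℤ) - 1 - ((π⁻¹ j : Fin N) : ℕ)) * μ j := by
    rw [satakeTwistExp, ← Equiv.sum_comp π (fun j : Fin N => ((N : ℤ) - 1 - ((π⁻¹ j : Fin N) : ℕ)) * μ j)]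
    exact Finset.sum_congr rfl fun i _ => by simp only [Function.comp_apply, Equiv.Perm.coe_inv, Equiv.symm_apply_apply]
  rw [h1, satakeTwistExp, ← Finset.sum_sub_distrib]
  exact Finset.sum_congr rfl fun j _ => by ring

/-- `2 ∣ ⟨ν, μ∘π⟩ - ⟨ν, μ⟩` for antisymmetric `μ` and `π ∈ C_{S_N}(rev)` (the summand `(j - π⁻¹ j) μ_j` is `rev`-even).
[cite: TreumannVenkatesh2016, §7.2] -/
theorem two_dvd_satakeTwistExp_comp_sub {μ : Fin N → ℤ} (hμ : ∀ i, μ (Fin.rev i) = -μ i) {π : Equiv.Perm (Fin N)}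
    (hπ : ∀ i, π (Fin.rev i) = Fin.rev (π i)) : (2 : ℤ) ∣ satakeTwistExp (μ ∘ π) - satakeTwistExp μ := by
  rw [satakeTwistExp_comp_perm_sub, sum_eq_two_mul_sum_ite_of_rev]
  · exact dvd_mul_right 2 _
  · intro j
    rw [hμ, perm_inv_rev hπ, Fin.val_rev, Fin.val_rev, Nat.cast_sub (Nat.succ_le_of_lt j.isLt),
      Nat.cast_sub (Nat.succ_le_of_lt (π⁻¹ j).isLt)]
    push_cast
    ring
  · intro j hj
    have h0 : μ j = 0 := by have := hμ j; rw [hj] at this; omega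
    rw [h0, mul_zero]

/-- `2 ∣ hs(μ∘π) - hs(μ)` for antisymmetric `μ` and `π ∈ C_{S_N}(rev)`: with the sign vector `s = 𝟙_{[0,h)} - 𝟙_{rev[0,h)}`,
`2hs(ν) = ∑ s ν` on antisymmetric `ν`, so `hs(μ∘π) - hs(μ) = ∑_{j<h} (s(π⁻¹j) - 1) μ_j` with `s(π⁻¹j) = ±1` (`π⁻¹ j` is not the
middle index). [cite: TreumannVenkatesh2016, §7.2] -/
theorem two_dvd_headSum_comp_sub {μ : Fin N → ℤ} (hμ : ∀ i, μ (Fin.rev i) = -μ i) {π : Equiv.Perm (Fin N)}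
    (hπ : ∀ i, π (Fin.rev i) = Fin.rev (π i)) : (2 : ℤ) ∣ headSum (μ ∘ π) (N / 2) - headSum μ (N / 2) := by
  -- the sign vector `s = 𝟙_{<h} - 𝟙_{rev < h}` and `t = s ∘ π⁻¹ - s`
  set s : Fin N → ℤ := fun x => (if (x : ℕ) < N / 2 then 1 else 0) - (if ((Fin.rev x : Fin N) : ℕ) < N / 2 then 1 else 0) with hs
  have hsrev : ∀ x, s (Fin.rev x) = -s x := fun x => by simp only [hs, Fin.rev_rev]; ring
  -- `∑ s ν = 2 hs(ν)` for antisymmetric `ν`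
  have hsum : ∀ ν : Fin N → ℤ, (∀ i, ν (Fin.rev i) = -ν i) → ∑ x, s x * ν x = 2 * headSum ν (N / 2) := by
    intro ν hν
    rw [headSum_eq, sum_eq_two_mul_sum_ite_of_rev]
    · congr 1
      refine Finset.sum_congr rfl fun x _ => ?_
      by_cases hx : (x : ℕ) < N / 2
      · have hx' : ¬ ((Fin.rev x : Fin N) : ℕ) < N / 2 := by rw [Fin.val_rev]; have := x.isLt; omega
        simp only [hs, if_pos hx, if_neg hx', sub_zero, one_mul]
      · rw [if_neg hx, if_neg hx]
    · intro x; rw [hsrev, hν]; ring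
    · intro x hx
      have : ν x = 0 := by have := hν x; rw [hx] at this; omega
      rw [this, mul_zero]
  have hνπ : ∀ i, (μ ∘ ⇑π) (Fin.rev i) = -(μ ∘ ⇑π) i := fun i => by rw [Function.comp_apply, Function.comp_apply, hπ, hμ]
  -- `∑ s (μ∘π) = ∑ (s∘π⁻¹) μ`
  have hre : ∑ x, s x * (μ ∘ ⇑π) x = ∑ j, s (π⁻¹ j) * μ j := by
    rw [← Equiv.sum_comp π (fun j : Fin N => s (π⁻¹ j) * μ j)]
    exact Finset.sum_congr rfl fun x _ => by simp only [Function.comp_apply, Equiv.Perm.coe_inv, Equiv.symm_apply_apply]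
  have hdiff : 2 * (headSum (μ ∘ π) (N / 2) - headSum μ (N / 2)) = ∑ j, (s (π⁻¹ j) - s j) * μ j := by
    rw [mul_sub, ← hsum _ hνπ, ← hsum μ hμ, hre, ← Finset.sum_sub_distrib]
    exact Finset.sum_congr rfl fun j _ => by ring
  -- pair up: `∑_j t_j μ_j = 2 ∑_{j<h} t_j μ_j`
  rw [sum_eq_two_mul_sum_ite_of_rev] at hdiff
  rotate_left
  · intro j
    rw [hμ, hsrev, perm_inv_rev hπ, hsrev]; ring
  · intro j hj
    have : μ j = 0 := by have := hμ j; rw [hj] at this; omega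
    rw [this, mul_zero]
  have hdiff' : headSum (μ ∘ π) (N / 2) - headSum μ (N / 2) = ∑ j : Fin N, if (j : ℕ) < N / 2 then (s (π⁻¹ j) - s j) * μ j else 0 :=
    mul_left_cancel₀ two_ne_zero hdiff
  rw [hdiff']
  refine Finset.dvd_sum fun j _ => ?_
  split_ifs with hj
  · -- `s j = 1`, `s (π⁻¹ j) = ±1`
    refine Dvd.dvd.mul_right ?_ _
    have hsj : s j = 1 := by
      have hx' : ¬ ((Fin.rev j : Fin N) : ℕ) < N / 2 := by rw [Fin.val_rev]; have := j.isLt; omega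
      simp only [hs, if_pos hj, if_neg hx', sub_zero]
    have hx := (π⁻¹ j).isLt
    have hmid : ¬ (2 * ((π⁻¹ j : Fin N) : ℕ) + 1 = N) := by
      intro h
      have h1 : Fin.rev (π⁻¹ j) = π⁻¹ j := (rev_eq_self_iff _).2 h
      rw [← perm_inv_rev hπ] at h1
      have h2 := π⁻¹.injective h1
      rw [rev_eq_self_iff] at h2
      omega
    have hsx : s (π⁻¹ j) = 1 ∨ s (π⁻¹ j) = -1 := by
      by_cases hx1 : ((π⁻¹ j : Fin N) : ℕ) < N / 2
      · left
        have hx2 : ¬ (N - (((π⁻¹ j : Fin N) : ℕ) + 1)) < N / 2 := by omega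
        simp only [hs, Fin.val_rev, if_pos hx1, if_neg hx2, sub_zero]
      · right
        have hx2 : N - (((π⁻¹ j : Fin N) : ℕ) + 1) < N / 2 := by omega
        simp only [hs, Fin.val_rev, if_neg hx1, if_pos hx2, zero_sub]
    rw [hsj]
    rcases hsx with h | h
    · rw [h, sub_self]; exact dvd_zero 2
    · rw [h]; exact ⟨-1, by norm_num⟩
  · exact dvd_zero 2

/-- **`Λ(μ∘π) ≡ Λ(μ) (mod 2)` for antisymmetric `μ` and `π ∈ W = C_{S_N}(rev)`** — Treumann–Venkatesh's «`Σ^*_G/wΣ^*_G` is divisible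
by `2` in that cocharacter lattice», which makes the exponent `⌊(Λ(μ∘π)-Λ(μ))/2⌋` of g49-#9's `orthogonalTwistedSatakeTarget` exact.
[cite: TreumannVenkatesh2016, §7.2] [cite: HenniartVigneras2013, §7.12 Lemma 2] -/
theorem two_dvd_orthogonalTwistExp_comp_sub {μ : Fin N → ℤ} (hμ : ∀ i, μ (Fin.rev i) = -μ i) {π : Equiv.Perm (Fin N)}
    (hπ : ∀ i, π (Fin.rev i) = Fin.rev (π i)) : (2 : ℤ) ∣ orthogonalTwistExp (μ ∘ π) - orthogonalTwistExp μ := by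
  rw [orthogonalTwistExp, orthogonalTwistExp, show satakeTwistExp (μ ∘ ⇑π) - headSum (μ ∘ ⇑π) (N / 2) -
    (satakeTwistExp μ - headSum μ (N / 2)) = (satakeTwistExp (μ ∘ ⇑π) - satakeTwistExp μ) -
    (headSum (μ ∘ ⇑π) (N / 2) - headSum μ (N / 2)) by ring]
  exact dvd_sub (two_dvd_satakeTwistExp_comp_sub hμ hπ) (two_dvd_headSum_comp_sub hμ hπ)

end Parity

/-! ## §2 `Λ` is minimal on each `W`-orbit at the antidominant element -/

section Minimal

/-- **No applicable correcting move ⇒ antidominant**: an antisymmetric `a` with no inversion inside the first block and `a_k ≤ 0`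
at its end is monotone (the move lemma of g49-#9 applied to `S = {a}`). [cite: BruhatTits1972, (4.4.3), (4.4.4)] -/
theorem monotone_of_forall_le_of_rev {a : Fin N → ℤ} (ha : ∀ i, a (Fin.rev i) = -a i)
    (h1 : ∀ j j' : Fin N, (j : ℕ) < (j' : ℕ) → (j' : ℕ) < N / 2 → a j ≤ a j')
    (h2 : ∀ k : Fin N, (k : ℕ) + 1 = N / 2 → a k ≤ 0) : Monotone a := by
  classical
  refine monotone_of_isMinOn_headSumVec_of_moves (S := {a}) (fun μ hμ j j' hjj' hj' hlt => ?_)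
    (fun μ hμ k hk hpos => ?_) (fun μ hμ => ?_) (Finset.mem_singleton_self a) (fun b hb => ?_)
  · rw [Finset.mem_singleton] at hμ
    rw [hμ] at hlt
    exact absurd (h1 j j' hjj' hj') (not_le.2 hlt)
  · rw [Finset.mem_singleton] at hμ
    rw [hμ] at hpos
    exact absurd (h2 k hk) (not_le.2 hpos)
  · rw [Finset.mem_singleton] at hμ
    rw [hμ]
    exact ha
  · rw [Finset.mem_singleton] at hb
    rw [hb]

omit [CommRing R] in
/-- A pair swap correcting an inversion `a_{j'} < a_j`, `j < j' < N/2`, lowers `⟨ν,·⟩` STRICTLY (by `2(j'-j)(a_j - a_{j'})`).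
[cite: BruhatTits1972, (4.4.3)] -/
theorem satakeTwistExp_comp_swapPairs_lt {a : Fin N → ℤ} (ha : ∀ i, a (Fin.rev i) = -a i) {j j' : Fin N}
    (hjj' : (j : ℕ) < (j' : ℕ)) (hj' : (j' : ℕ) < N / 2) (hlt : a j' < a j) :
    satakeTwistExp (a ∘ ⇑(swapPairs j j')) < satakeTwistExp a := by
  have hjv := j.isLt; have hj'v := j'.isLt
  rw [swapPairs, Equiv.Perm.coe_mul, ← Function.comp_assoc, satakeTwistExp_comp_swap, satakeTwistExp_comp_swap]
  have h1 : (a ∘ ⇑(Equiv.swap j j')) (Fin.rev j') = -a j' := by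
    rw [Function.comp_apply, Equiv.swap_apply_of_ne_of_ne, ha]
    · intro h; have := congrArg Fin.val h; rw [Fin.val_rev] at this; omega
    · intro h; have := congrArg Fin.val h; rw [Fin.val_rev] at this; omega
  have h2 : (a ∘ ⇑(Equiv.swap j j')) (Fin.rev j) = -a j := by
    rw [Function.comp_apply, Equiv.swap_apply_of_ne_of_ne, ha]
    · intro h; have := congrArg Fin.val h; rw [Fin.val_rev] at this; omega
    · intro h; have := congrArg Fin.val h; rw [Fin.val_rev] at this; omega
  rw [h1, h2, Fin.val_rev, Fin.val_rev, Nat.cast_sub (by omega), Nat.cast_sub (by omega)]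
  push_cast
  have h3 : (0 : ℤ) < ((j' : ℕ) : ℤ) - ((j : ℕ) : ℤ) := by omega
  nlinarith [mul_pos h3 (sub_pos.2 hlt)]

omit [CommRing R] in
/-- The same pair swap lowers `Λ` strictly (`hs` is unchanged). [cite: BruhatTits1972, (4.4.3)] -/
theorem orthogonalTwistExp_comp_swapPairs_lt {a : Fin N → ℤ} (ha : ∀ i, a (Fin.rev i) = -a i) {j j' : Fin N}
    (hjj' : (j : ℕ) < (j' : ℕ)) (hj' : (j' : ℕ) < N / 2) (hlt : a j' < a j) :
    orthogonalTwistExp (a ∘ ⇑(swapPairs j j')) < orthogonalTwistExp a := by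
  have hne : j ≠ j' := fun h => by rw [h] at hjj'; exact lt_irrefl _ hjj'
  rw [orthogonalTwistExp, orthogonalTwistExp, headSum_comp_swapPairs a hne (lt_trans hjj' hj') hj']
  linarith [satakeTwistExp_comp_swapPairs_lt ha hjj' hj' hlt]

omit [CommRing R] in
/-- The flip `(k, rev k)` with `2k + 2 < N` (every first-block `k` when `N` is odd) applied to an antisymmetric `a` with `0 < a_k`
lowers `Λ` STRICTLY (by `2a_k(N-2-2k) > 0`). [cite: BruhatTits1972, (4.4.3)] -/
theorem orthogonalTwistExp_comp_flipPair_lt {a : Fin N → ℤ} (ha : ∀ i, a (Fin.rev i) = -a i) {k : Fin N} (hk : 2 * (k : ℕ) + 2 < N)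
    (hpos : 0 < a k) : orthogonalTwistExp (a ∘ ⇑(flipPair k)) < orthogonalTwistExp a := by
  have hkv := k.isLt
  rw [orthogonalTwistExp, orthogonalTwistExp, headSum_comp_flipPair a (by omega), flipPair, satakeTwistExp_comp_swap, ha,
    Fin.val_rev, Nat.cast_sub (by omega)]
  push_cast
  have h1 : (0 : ℤ) < (N : ℤ) - 2 - 2 * ((k : ℕ) : ℤ) := by omega
  nlinarith [mul_pos h1 hpos]

omit [CommRing R] in
/-- **`Λ(λ) ≤ Λ(μ)` for every `μ` in the `W`-orbit of an antidominant antisymmetric `λ`** («`A(w(λ)) ≥ A(λ)`»): the head-sum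
lexicographic minimum of `{ν ∈ Wλ : Λ(ν) ≤ Λ(μ)}` is antidominant, hence equals `λ`. [cite: HenniartVigneras2013, §7.12 Lemma 2, §7.16]
[cite: ZhuIntegralSatake2020, §1.3 Lemma 8] -/
theorem orthogonalTwistExp_le_of_mem_weylOrbitRev {la μ : Fin N → ℤ} (hla : Monotone la ∧ ∀ i, la (Fin.rev i) = -la i)
    (hμ : μ ∈ weylOrbitRev la) : orthogonalTwistExp la ≤ orthogonalTwistExp μ := by
  classical
  set S : Finset (Fin N → ℤ) := (weylOrbitRev la).filter fun ν => orthogonalTwistExp ν ≤ orthogonalTwistExp μ with hS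
  have hμS : μ ∈ S := Finset.mem_filter.2 ⟨hμ, le_rfl⟩
  have hstab : ∀ ν ∈ S, ∀ π : Equiv.Perm (Fin N), (∀ i, π (Fin.rev i) = Fin.rev (π i)) →
      orthogonalTwistExp (ν ∘ π) ≤ orthogonalTwistExp ν → ν ∘ π ∈ S := fun ν hν π hπ hle => by
    obtain ⟨hν1, hν2⟩ := Finset.mem_filter.1 hν
    exact Finset.mem_filter.2 ⟨(comp_mem_weylOrbitRev_iff hπ).2 hν1, hle.trans hν2⟩
  have hanti : ∀ ν ∈ S, ∀ i, ν (Fin.rev i) = -ν i := fun ν hν => rev_of_mem_weylOrbitRev hla.2 (Finset.mem_filter.1 hν).1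
  obtain ⟨a, haS, hmin⟩ := S.exists_min_image (fun ν => toLex (headSumVec ν)) ⟨μ, hμS⟩
  have hmono := monotone_of_isMinOn_headSumVec_orthogonal hstab hanti haS hmin
  have hala : a = la := eq_of_monotone_of_mem_weylOrbitRev hla.1 hmono (Finset.mem_filter.1 haS).1
  rw [← hala]
  exact (Finset.mem_filter.1 haS).2

omit [CommRing R] in
/-- On a `W`-orbit the twist exponents `Λ(μ) - Λ(λ)` are even. [cite: TreumannVenkatesh2016, §7.2] -/
theorem two_dvd_orthogonalTwistExp_sub_of_mem_weylOrbitRev {la μ : Fin N → ℤ} (hla : ∀ i, la (Fin.rev i) = -la i)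
    (hμ : μ ∈ weylOrbitRev la) : (2 : ℤ) ∣ orthogonalTwistExp μ - orthogonalTwistExp la := by
  obtain ⟨π, hπ, rfl⟩ := mem_weylOrbitRev_iff.1 hμ
  exact two_dvd_orthogonalTwistExp_comp_sub hla hπ

omit [CommRing R] in
/-- **For `N` odd, `Λ` attains its minimum on `Wλ` only at `λ`**: if `μ ∈ Wλ` and `Λ(μ) ≤ Λ(λ)` then `μ = λ` (each correcting move
lowers `Λ` strictly, contradicting minimality). [cite: HenniartVigneras2013, §7.13 Prop., §7.16] [cite: Herzig2010, §1.2] -/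
theorem eq_of_orthogonalTwistExp_le_of_mem_weylOrbitRev_odd (hN : ¬ 2 ∣ N) {la μ : Fin N → ℤ}
    (hla : Monotone la ∧ ∀ i, la (Fin.rev i) = -la i) (hμ : μ ∈ weylOrbitRev la)
    (hle : orthogonalTwistExp μ ≤ orthogonalTwistExp la) : μ = la := by
  have hanti : ∀ i, μ (Fin.rev i) = -μ i := rev_of_mem_weylOrbitRev hla.2 hμ
  refine eq_of_monotone_of_mem_weylOrbitRev hla.1 (monotone_of_forall_le_of_rev hanti (fun j j' hjj' hj' => ?_) fun k hk => ?_) hμ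
  · by_contra hlt
    rw [not_le] at hlt
    have hne : j ≠ j' := fun h => by rw [h] at hjj'; exact lt_irrefl _ hjj'
    have h1 := orthogonalTwistExp_comp_swapPairs_lt hanti hjj' hj' hlt
    have h2 := orthogonalTwistExp_le_of_mem_weylOrbitRev hla
      ((comp_mem_weylOrbitRev_iff (swapPairs_rev hne (lt_trans hjj' hj') hj')).2 hμ)
    exact absurd (h2.trans_lt h1) (not_lt.2 hle)
  · by_contra hpos
    rw [not_le] at hpos
    have h1 := orthogonalTwistExp_comp_flipPair_lt hanti (by omega) hpos
    have h2 := orthogonalTwistExp_le_of_mem_weylOrbitRev hla ((comp_mem_weylOrbitRev_iff (flipPair_rev k)).2 hμ)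
    exact absurd (h2.trans_lt h1) (not_lt.2 hle)

end Minimal

/-! ## §3 The orthogonal twisted orbit sums `S^{O}_λ` -/

section OrbitSum

variable (R N) in
/-- **The orthogonal twisted orbit sum `S^{O}_λ = ∑_{μ ∈ Wλ} q^{(Λ(μ)-Λ(λ))/2} x^μ ∈ R[ℤ^N]`** (Henniart–Vignéras' `S_λ` for `O_N(J₀)`).
[cite: HenniartVigneras2013, §7.13] [cite: TreumannVenkatesh2016, §7.2] -/
def orthogonalTwistedOrbitSum (q : ℕ) (la : Fin N → ℤ) : AddMonoidAlgebra R (Fin N → ℤ) :=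
  ∑ μ ∈ weylOrbitRev la, ((q : R) ^ ((orthogonalTwistExp μ - orthogonalTwistExp la) / 2).toNat) • AddMonoidAlgebra.single μ (1 : R)

/-- Coefficients of `S^{O}_λ`. [cite: HenniartVigneras2013, §7.13] -/
theorem coeff_orthogonalTwistedOrbitSum (q : ℕ) (la μ : Fin N → ℤ) :
    (orthogonalTwistedOrbitSum R N q la).coeff μ =
      if μ ∈ weylOrbitRev la then (q : R) ^ ((orthogonalTwistExp μ - orthogonalTwistExp la) / 2).toNat else 0 := by
  classical
  rw [orthogonalTwistedOrbitSum, AddMonoidAlgebra.coeff_sum, Finsupp.finsetSum_apply]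
  simp only [AddMonoidAlgebra.coeff_smul, Finsupp.smul_apply, AddMonoidAlgebra.coeff_single, Finsupp.single_apply,
    smul_eq_mul, mul_ite, mul_one, mul_zero]
  rw [Finset.sum_ite_eq']

/-- `S^{O}_λ` has coefficient `1` at `x^λ`. [cite: HenniartVigneras2013, §7.13] -/
theorem coeff_orthogonalTwistedOrbitSum_self (q : ℕ) (la : Fin N → ℤ) : (orthogonalTwistedOrbitSum R N q la).coeff la = 1 := by
  rw [coeff_orthogonalTwistedOrbitSum, if_pos (self_mem_weylOrbitRev la), sub_self, show ((0 : ℤ) / 2).toNat = 0 by decide, pow_zero]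

/-- For `λ` and `μ ≠ λ` both antidominant, `S^{O}_λ` has no `x^μ` term. [cite: HenniartVigneras2013, §7.13 Prop. (proof)] -/
theorem coeff_orthogonalTwistedOrbitSum_eq_zero_of_monotone {q : ℕ} {la μ : Fin N → ℤ} (hla : Monotone la) (hμ : Monotone μ)
    (hne : μ ≠ la) : (orthogonalTwistedOrbitSum R N q la).coeff μ = 0 := by
  rw [coeff_orthogonalTwistedOrbitSum, if_neg]
  exact fun h => hne (eq_of_monotone_of_mem_weylOrbitRev hla hμ h)

/-- **`S^{O}_λ ∈ 𝒯^{O}_R(q)`** for antidominant antisymmetric `λ`: the exponents `(Λ(μ)-Λ(λ))/2` are natural numbers (§2) adding up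
along the orbit (§1 parity). [cite: HenniartVigneras2013, §7.13] [cite: TreumannVenkatesh2016, §7.2] -/
theorem orthogonalTwistedOrbitSum_mem_orthogonalTwistedSatakeTarget (q : ℕ) {la : Fin N → ℤ}
    (hla : Monotone la ∧ ∀ i, la (Fin.rev i) = -la i) :
    orthogonalTwistedOrbitSum R N q la ∈ orthogonalTwistedSatakeTarget R N q := by
  refine ⟨fun μ hμ => ?_, fun π hπ μ hle => ?_⟩
  · rw [coeff_orthogonalTwistedOrbitSum, if_neg]
    exact fun h => hμ (rev_of_mem_weylOrbitRev hla.2 h)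
  · rw [coeff_orthogonalTwistedOrbitSum, coeff_orthogonalTwistedOrbitSum]
    by_cases hμ : μ ∈ weylOrbitRev la
    · rw [if_pos ((comp_mem_weylOrbitRev_iff hπ).2 hμ), if_pos hμ, ← pow_add]
      congr 1
      have h1 := orthogonalTwistExp_le_of_mem_weylOrbitRev hla hμ
      have h2 := two_dvd_orthogonalTwistExp_sub_of_mem_weylOrbitRev hla.2 hμ
      have h3 := two_dvd_orthogonalTwistExp_comp_sub (rev_of_mem_weylOrbitRev hla.2 hμ) hπ
      omega
    · rw [if_neg (fun h => hμ ((comp_mem_weylOrbitRev_iff hπ).1 h)), if_neg hμ, mul_zero]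

/-- **`S^{O}_λ = x^λ` when `q = 0` in `R` and `N` is odd**: every other orbit element has `Λ(μ) ≥ Λ(λ) + 2`.
[cite: HenniartVigneras2013, §7.15 Remark 1] -/
theorem orthogonalTwistedOrbitSum_of_cast_eq_zero_odd (hN : ¬ 2 ∣ N) {q : ℕ} (hq : (q : R) = 0) {la : Fin N → ℤ}
    (hla : Monotone la ∧ ∀ i, la (Fin.rev i) = -la i) :
    orthogonalTwistedOrbitSum R N q la = AddMonoidAlgebra.single la (1 : R) := by
  classical
  refine AddMonoidAlgebra.coeff_injective (Finsupp.ext fun μ => ?_)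
  rw [coeff_orthogonalTwistedOrbitSum, AddMonoidAlgebra.coeff_single, Finsupp.single_apply]
  by_cases hμ : μ ∈ weylOrbitRev la
  · rw [if_pos hμ]
    by_cases heq : la = μ
    · rw [if_pos heq, heq, sub_self, show ((0 : ℤ) / 2).toNat = 0 by decide, pow_zero]
    · rw [if_neg heq, hq, zero_pow]
      intro h0
      have h1 := orthogonalTwistExp_le_of_mem_weylOrbitRev hla hμ
      have h2 := two_dvd_orthogonalTwistExp_sub_of_mem_weylOrbitRev hla.2 hμ
      have h3 : ¬ orthogonalTwistExp μ ≤ orthogonalTwistExp la := fun h =>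
        heq (eq_of_orthogonalTwistExp_le_of_mem_weylOrbitRev_odd hN hla hμ h).symm
      omega
  · rw [if_neg hμ, if_neg]
    rintro rfl
    exact hμ (self_mem_weylOrbitRev la)

end OrbitSum

/-! ## §4 `(S^{O}_λ)_{λ ∈ Λ⁻}` is an `R`-basis of `𝒯^{O}_R(b)` -/

section BasisTarget

/-- **An element of `𝒯^{O}_R` is detected on the antidominant cone**: if `f ∈ 𝒯^{O}_R(b)` and `f_μ ≠ 0` then `f_λ ≠ 0` at the
antidominant element `λ` of `Wμ` (`Λ(λ) ≤ Λ(μ)`, §2, and g49-#9 `coeff_ne_zero_comp_of_mem_orthogonalTwisted`).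
[cite: HenniartVigneras2013, §7.13 Cor. (proof)] -/
theorem exists_monotone_coeff_ne_zero_of_mem_orthogonalTwisted {b : ℕ} {f : AddMonoidAlgebra R (Fin N → ℤ)}
    (hf : f ∈ orthogonalTwistedSatakeTarget R N b) {μ : Fin N → ℤ} (hμ : f.coeff μ ≠ 0) :
    ∃ la : Fin N → ℤ, Monotone la ∧ (∀ i, la (Fin.rev i) = -la i) ∧ μ ∈ weylOrbitRev la ∧ f.coeff la ≠ 0 := by
  have hanti : ∀ i, μ (Fin.rev i) = -μ i := by
    by_contra h
    exact hμ (hf.1 μ h)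
  obtain ⟨la, hla1, hla2, hμla⟩ := exists_monotone_mem_weylOrbitRev hanti
  obtain ⟨π, hπ, hπμ⟩ := mem_weylOrbitRev_iff.1 hμla
  refine ⟨la, hla1, hla2, hμla, ?_⟩
  have h1 : μ ∘ ⇑π⁻¹ = la := by
    rw [← hπμ, Function.comp_assoc, ← Equiv.Perm.coe_mul, mul_inv_cancel, Equiv.Perm.coe_one, Function.comp_id]
  rw [← h1]
  refine coeff_ne_zero_comp_of_mem_orthogonalTwisted hf hμ (perm_inv_rev hπ) ?_
  rw [h1]
  exact orthogonalTwistExp_le_of_mem_weylOrbitRev ⟨hla1, hla2⟩ hμla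

/-- **`f = ∑_{λ ∈ Λ⁻ ∩ supp f} f_λ S^{O}_λ` for every `f ∈ 𝒯^{O}_R(b)`**. [cite: HenniartVigneras2013, §7.13 Cor.] -/
theorem eq_sum_coeff_smul_orthogonalTwistedOrbitSum_of_mem {b : ℕ} {f : AddMonoidAlgebra R (Fin N → ℤ)}
    (hf : f ∈ orthogonalTwistedSatakeTarget R N b) :
    f = ∑ la ∈ f.coeff.support.filter Monotone, f.coeff la • orthogonalTwistedOrbitSum R N b la := by
  classical
  rw [← sub_eq_zero]
  set g := f - ∑ la ∈ f.coeff.support.filter Monotone, f.coeff la • orthogonalTwistedOrbitSum R N b la with hg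
  have hgmem : g ∈ orthogonalTwistedSatakeTarget R N b := by
    refine Submodule.sub_mem _ hf (Submodule.sum_mem _ fun la hla => Submodule.smul_mem _ _
      (orthogonalTwistedOrbitSum_mem_orthogonalTwistedSatakeTarget b ⟨(Finset.mem_filter.1 hla).2, ?_⟩))
    by_contra h
    exact Finsupp.mem_support_iff.1 (Finset.mem_filter.1 hla).1 (hf.1 la h)
  have hgm : ∀ m : Fin N → ℤ, Monotone m → g.coeff m = 0 := by
    intro m hm
    rw [hg, AddMonoidAlgebra.coeff_sub, Finsupp.sub_apply, AddMonoidAlgebra.coeff_sum, Finsupp.finsetSum_apply, sub_eq_zero]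
    simp only [AddMonoidAlgebra.coeff_smul, Finsupp.smul_apply, smul_eq_mul]
    rw [Finset.sum_eq_single m (fun la hla hne => ?_) (fun hm' => ?_), coeff_orthogonalTwistedOrbitSum_self, mul_one]
    · rw [coeff_orthogonalTwistedOrbitSum_eq_zero_of_monotone (Finset.mem_filter.1 hla).2 hm (Ne.symm hne), mul_zero]
    · have h0 : f.coeff m = 0 := by
        by_contra h0
        exact hm' (Finset.mem_filter.2 ⟨Finsupp.mem_support_iff.2 h0, hm⟩)
      rw [h0, zero_mul]
  by_contra hne
  obtain ⟨μ, hμ⟩ : ∃ μ, g.coeff μ ≠ 0 := by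
    by_contra hall
    push Not at hall
    exact hne (AddMonoidAlgebra.coeff_eq_zero.1 (Finsupp.ext hall))
  obtain ⟨la, hla, -, -, hgla⟩ := exists_monotone_coeff_ne_zero_of_mem_orthogonalTwisted hgmem hμ
  exact hgla (hgm la hla)

/-- **The orthogonal twisted orbit sums `S^{O}_λ`, `λ ∈ Λ⁻`, are `R`-linearly independent.** [cite: HenniartVigneras2013, §7.13 Prop.] -/
theorem linearIndependent_orthogonalTwistedOrbitSum (b : ℕ) :
    LinearIndependent R fun la : {la : Fin N → ℤ // Monotone la ∧ ∀ i, la (Fin.rev i) = -la i} =>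
      orthogonalTwistedOrbitSum R N b la.1 := by
  classical
  rw [linearIndependent_iff']
  intro s g hsum la hla
  have h := congrArg (fun x : AddMonoidAlgebra R (Fin N → ℤ) => x.coeff la.1) hsum
  rw [AddMonoidAlgebra.coeff_sum, Finsupp.finsetSum_apply, AddMonoidAlgebra.coeff_zero, Finsupp.zero_apply,
    Finset.sum_eq_single la (fun la' _ hne => ?_) (fun h' => absurd hla h'), AddMonoidAlgebra.coeff_smul, Finsupp.smul_apply,
    coeff_orthogonalTwistedOrbitSum_self, smul_eq_mul, mul_one] at h
  · exact h
  · rw [AddMonoidAlgebra.coeff_smul, Finsupp.smul_apply,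
      coeff_orthogonalTwistedOrbitSum_eq_zero_of_monotone la'.2.1 la.2.1 (fun he => hne (Subtype.ext he.symm)), smul_zero]

/-- **`(S^{O}_λ)_{λ ∈ Λ⁻}` IS AN `R`-BASIS OF `𝒯^{O}_R(b)`**, for every commutative ring `R` and every base `b`.
[cite: HenniartVigneras2013, §7.13 Cor.] [cite: TreumannVenkatesh2016, §7.2] -/
theorem exists_basis_orthogonalTwistedSatakeTarget (b : ℕ) :
    ∃ B : Module.Basis {la : Fin N → ℤ // Monotone la ∧ ∀ i, la (Fin.rev i) = -la i} R (orthogonalTwistedSatakeTarget R N b),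
      ∀ la, (B la : AddMonoidAlgebra R (Fin N → ℤ)) = orthogonalTwistedOrbitSum R N b la.1 := by
  classical
  set v : {la : Fin N → ℤ // Monotone la ∧ ∀ i, la (Fin.rev i) = -la i} → orthogonalTwistedSatakeTarget R N b :=
    fun la => ⟨orthogonalTwistedOrbitSum R N b la.1, orthogonalTwistedOrbitSum_mem_orthogonalTwistedSatakeTarget b la.2⟩ with hv
  have hli : LinearIndependent R v :=
    LinearIndependent.of_comp (orthogonalTwistedSatakeTarget R N b).subtype (linearIndependent_orthogonalTwistedOrbitSum b)
  have hsp : ⊤ ≤ Submodule.span R (Set.range v) := by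
    rintro ⟨f, hf⟩ -
    rw [← Submodule.apply_mem_span_image_iff_mem_span (Submodule.injective_subtype _), ← Set.range_comp,
      Submodule.subtype_apply]
    change f ∈ _
    rw [eq_sum_coeff_smul_orthogonalTwistedOrbitSum_of_mem hf]
    refine Submodule.sum_mem _ fun la hla => Submodule.smul_mem _ _ (Submodule.subset_span ⟨⟨la, (Finset.mem_filter.1 hla).2, ?_⟩, rfl⟩)
    by_contra h
    exact Finsupp.mem_support_iff.1 (Finset.mem_filter.1 hla).1 (hf.1 la h)
  exact ⟨Module.Basis.mk hli hsp, fun la => by rw [Module.Basis.mk_apply]⟩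

end BasisTarget

/-! ## §5 The mod-`p` description of `𝒯^{O}_R` for `N` odd -/

section ModP

/-- **`𝒯^{O}_R(q) = R[Λ⁻]` when `q = 0` in `R` and `N` is odd**: `f ∈ 𝒯^{O}_R(q)` iff every exponent of `f` is antidominant and
antisymmetric (the relation at the antidominant element `λ` of `Wμ` reads `f_μ = 0^{(Λ(μ)-Λ(λ))/2} f_λ`, and `Λ(μ) ≥ Λ(λ) + 2` unless
`μ = λ`). [cite: Herzig2010, Thm. 1.2, §1.2] [cite: HenniartVigneras2013, Thm. 1.5 (ii), §7.15 Remark 1] -/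
theorem mem_orthogonalTwistedSatakeTarget_iff_of_cast_eq_zero_odd (hN : ¬ 2 ∣ N) {q : ℕ} (hq : (q : R) = 0)
    (f : AddMonoidAlgebra R (Fin N → ℤ)) :
    f ∈ orthogonalTwistedSatakeTarget R N q ↔ ∀ μ : Fin N → ℤ, f.coeff μ ≠ 0 → Monotone μ ∧ ∀ i, μ (Fin.rev i) = -μ i := by
  constructor
  · intro hf μ hμ
    have hanti : ∀ i, μ (Fin.rev i) = -μ i := by
      by_contra h
      exact hμ (hf.1 μ h)
    refine ⟨?_, hanti⟩
    obtain ⟨la, hla1, hla2, hμla⟩ := exists_monotone_mem_weylOrbitRev hanti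
    obtain ⟨π, hπ, hπμ⟩ := mem_weylOrbitRev_iff.1 hμla
    have hle : orthogonalTwistExp la ≤ orthogonalTwistExp (la ∘ π) := by
      rw [hπμ]; exact orthogonalTwistExp_le_of_mem_weylOrbitRev ⟨hla1, hla2⟩ hμla
    have hrel := hf.2 π hπ la hle
    rw [hπμ] at hrel hle
    rcases Nat.eq_zero_or_pos ((orthogonalTwistExp μ - orthogonalTwistExp la) / 2).toNat with h0 | hpos
    · have h2 := two_dvd_orthogonalTwistExp_sub_of_mem_weylOrbitRev hla2 hμla
      have heq : μ = la := eq_of_orthogonalTwistExp_le_of_mem_weylOrbitRev_odd hN ⟨hla1, hla2⟩ hμla (by omega)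
      rw [heq]
      exact hla1
    · exact absurd (by rw [hrel, hq, zero_pow hpos.ne', zero_mul]) hμ
  · intro h
    refine ⟨fun μ hμ => ?_, fun π hπ μ hle => ?_⟩
    · by_contra h0
      exact hμ (h μ h0).2
    · by_cases hμ0 : f.coeff μ = 0
      · rw [hμ0, mul_zero]
        by_contra hne
        obtain ⟨hm1, hm2⟩ := h _ hne
        have hμmem : μ ∈ weylOrbitRev (μ ∘ ⇑π) :=
          mem_weylOrbitRev_iff.2 ⟨π⁻¹, perm_inv_rev hπ, by
            rw [Function.comp_assoc, ← Equiv.Perm.coe_mul, mul_inv_cancel, Equiv.Perm.coe_one, Function.comp_id]⟩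
        have heq := eq_of_orthogonalTwistExp_le_of_mem_weylOrbitRev_odd hN ⟨hm1, hm2⟩ hμmem hle
        exact hne (by rw [← heq]; exact hμ0)
      · obtain ⟨hm1, hm2⟩ := h μ hμ0
        have hmem : μ ∘ ⇑π ∈ weylOrbitRev μ := (comp_mem_weylOrbitRev_iff hπ).2 (self_mem_weylOrbitRev μ)
        by_cases hle' : orthogonalTwistExp (μ ∘ π) ≤ orthogonalTwistExp μ
        · rw [eq_of_orthogonalTwistExp_le_of_mem_weylOrbitRev_odd hN ⟨hm1, hm2⟩ hmem hle', sub_self,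
            show ((0 : ℤ) / 2).toNat = 0 by decide, pow_zero, one_mul]
        · have h2 := two_dvd_orthogonalTwistExp_sub_of_mem_weylOrbitRev hm2 hmem
          have hpos : 0 < ((orthogonalTwistExp (μ ∘ π) - orthogonalTwistExp μ) / 2).toNat := by omega
          rw [hq, zero_pow hpos.ne', zero_mul]
          by_contra hne
          have h3 := eq_of_monotone_of_mem_weylOrbitRev hm1 (h _ hne).1 hmem
          exact hle' (by rw [h3])

end ModP

variable {K : Type*} [Field K] [Valued K ℤᵐ⁰] {ϖ : K}

namespace UnramifiedLocalConjDatum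

/-- **`q = 0` in every ring of characteristic `p = char 𝓀`** (`q = #𝓀 = p^n`, `n ≥ 1`). [cite: Herzig2010, §1.2]
[cite: HenniartVigneras2013, §7.15 Remark 1] -/
theorem natCast_card_residueField_eq_zero_of_charP [Finite 𝓀[K]] (p : ℕ) [CharP 𝓀[K] p] [CharP R p] :
    ((Nat.card 𝓀[K] : ℕ) : R) = 0 := by
  haveI := Fintype.ofFinite 𝓀[K]
  obtain ⟨n, -, hcard⟩ := FiniteField.card 𝓀[K] p
  rw [Nat.card_eq_fintype_card, hcard, Nat.cast_pow, CharP.cast_eq_zero R p, zero_pow (PNat.ne_zero n)]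

variable [Finite 𝓀[K]]
  [IsHeckeTriple (⊤ : Submonoid (unitaryGroupOfForm (RingHom.id K) ((StdForm.antidiagonal N).over K)))
    (unitaryInt (RingHom.id K) ((StdForm.antidiagonal N).over K)) (unitaryInt (RingHom.id K) ((StdForm.antidiagonal N).over K))]

/-! ### The orbit-sum basis of `𝒮_1(ℋ(O_N(J₀), K₀; R))` and the freeness of `ℋ(O_N(J₀), K₀; R)` -/

/-- **`S^{O}_λ ∈ 𝒮_1(ℋ(O_N(J₀), K₀; R))`** for every antidominant antisymmetric `λ` and every commutative `R`.
[cite: HenniartVigneras2013, §7.14, §7.15] -/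
theorem orthogonalTwistedOrbitSum_mem_range_satakeTransform_one (hd : UnramifiedLocalConjDatum (RingHom.id K) ϖ)
    {la : Fin N → ℤ} (hla : Monotone la ∧ ∀ i, la (Fin.rev i) = -la i) :
    ∃ T : heckeAlgebra R (unitaryGroupOfForm (RingHom.id K) ((StdForm.antidiagonal N).over K))
        (unitaryInt (RingHom.id K) ((StdForm.antidiagonal N).over K)),
      (hd.isIwasawaExponent (N := N)).satakeTransform 1 T = orthogonalTwistedOrbitSum R N (Nat.card 𝓀[K]) la :=
  hd.exists_satakeTransform_one_eq_of_mem_orthogonalTwisted _ (orthogonalTwistedOrbitSum_mem_orthogonalTwistedSatakeTarget _ hla)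

/-- **HENNIART–VIGNÉRAS §7.13/§7.15 FOR `O_N(J₀)`: the orbit sums `S^{O}_λ`, `λ ∈ Λ⁻`, form an `R`-BASIS OF THE IMAGE
`𝒮_1(ℋ(O_N(J₀), K₀; R))`**, for every commutative ring `R`. [cite: HenniartVigneras2013, §7.13 Thm., §7.15 Thm.]
[cite: TreumannVenkatesh2016, §7.2 Thm. (i)] -/
theorem exists_basis_range_satakeTransform_one_orthogonal (hd : UnramifiedLocalConjDatum (RingHom.id K) ϖ) :
    ∃ B : Module.Basis {la : Fin N → ℤ // Monotone la ∧ ∀ i, la (Fin.rev i) = -la i} R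
        (LinearMap.range ((hd.isIwasawaExponent (N := N)).satakeTransform (1 : Multiplicative (Fin N → ℤ) →* R)).toLinearMap),
      ∀ la, (B la : AddMonoidAlgebra R (Fin N → ℤ)) = orthogonalTwistedOrbitSum R N (Nat.card 𝓀[K]) la.1 := by
  rw [hd.range_satakeTransform_one_eq_orthogonalTwistedSatakeTarget]
  exact exists_basis_orthogonalTwistedSatakeTarget _

/-- **`ℋ(O_N(J₀), K₀; R)` IS A FREE `R`-MODULE WITH A BASIS `(B_λ)_{λ ∈ Λ⁻}`, `𝒮_1(B_λ) = S^{O}_λ`**, for every commutative ring `R`.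
[cite: HenniartVigneras2013, §7.15 Thm.] -/
theorem exists_basis_heckeAlgebra_satakeTransform_one_eq_orthogonalTwistedOrbitSum (hd : UnramifiedLocalConjDatum (RingHom.id K) ϖ) :
    ∃ B : Module.Basis {la : Fin N → ℤ // Monotone la ∧ ∀ i, la (Fin.rev i) = -la i} R
        (heckeAlgebra R (unitaryGroupOfForm (RingHom.id K) ((StdForm.antidiagonal N).over K))
          (unitaryInt (RingHom.id K) ((StdForm.antidiagonal N).over K))),
      ∀ la, (hd.isIwasawaExponent (N := N)).satakeTransform (1 : Multiplicative (Fin N → ℤ) →* R) (B la) =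
        orthogonalTwistedOrbitSum R N (Nat.card 𝓀[K]) la.1 := by
  obtain ⟨B₀, hB₀⟩ := exists_basis_orthogonalTwistedSatakeTarget (R := R) (N := N) (Nat.card 𝓀[K])
  refine ⟨B₀.map hd.countingSatakeLinearEquivOrthogonal.symm, fun la => ?_⟩
  rw [Module.Basis.map_apply]
  have h1 := hd.countingSatakeLinearEquivOrthogonal_apply (hd.countingSatakeLinearEquivOrthogonal.symm (B₀ la))
  rw [LinearEquiv.apply_symm_apply] at h1
  rw [← h1, hB₀]

/-! ### Herzig / Henniart–Vignéras for `O_N(J₀)`, `N` odd -/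

/-- **For `N` odd and `q = 0` in `R`, every exponent of `𝒮_1(T)` is antidominant antisymmetric**, for every
`T ∈ ℋ(O_N(J₀), K₀; R)`. [cite: Herzig2010, Thm. 1.2] [cite: HenniartVigneras2013, Thm. 1.5 (ii)] -/
theorem monotone_of_coeff_satakeTransform_one_ne_zero_orthogonal_odd (hd : UnramifiedLocalConjDatum (RingHom.id K) ϖ)
    (hN : ¬ 2 ∣ N) (hq : ((Nat.card 𝓀[K] : ℕ) : R) = 0)
    (T : heckeAlgebra R (unitaryGroupOfForm (RingHom.id K) ((StdForm.antidiagonal N).over K))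
      (unitaryInt (RingHom.id K) ((StdForm.antidiagonal N).over K)))
    {μ : Fin N → ℤ} (hμ : ((hd.isIwasawaExponent (N := N)).satakeTransform (1 : Multiplicative (Fin N → ℤ) →* R) T).coeff μ ≠ 0) :
    Monotone μ ∧ ∀ i, μ (Fin.rev i) = -μ i :=
  (mem_orthogonalTwistedSatakeTarget_iff_of_cast_eq_zero_odd hN hq _).1 (hd.satakeTransform_one_mem_orthogonalTwistedSatakeTarget T) μ hμ

/-- **THE MOD-`p` SATAKE ISOMORPHISM FOR `O_N(J₀)`, `N` ODD, OVER EVERY COMMUTATIVE RING `R` WITH `q = 0` IN `R`**: `f ∈ R[ℤ^N]` is a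
counting transform `𝒮_1(T)`, `T ∈ ℋ(O_N(J₀), K₀; R)`, iff every exponent of `f` is antidominant and antisymmetric.
[cite: Herzig2010, Thm. 1.2] [cite: HenniartVigneras2013, Thm. 1.5 (ii), §7.15] -/
theorem mem_range_satakeTransform_one_iff_of_cast_eq_zero_orthogonal_odd (hd : UnramifiedLocalConjDatum (RingHom.id K) ϖ)
    (hN : ¬ 2 ∣ N) (hq : ((Nat.card 𝓀[K] : ℕ) : R) = 0) (f : AddMonoidAlgebra R (Fin N → ℤ)) :
    f ∈ ((hd.isIwasawaExponent (N := N)).satakeTransform (1 : Multiplicative (Fin N → ℤ) →* R)).range ↔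
      ∀ μ : Fin N → ℤ, f.coeff μ ≠ 0 → Monotone μ ∧ ∀ i, μ (Fin.rev i) = -μ i := by
  rw [← mem_orthogonalTwistedSatakeTarget_iff_of_cast_eq_zero_odd hN hq, ← hd.range_satakeTransform_one_eq_orthogonalTwistedSatakeTarget,
    AlgHom.mem_range, LinearMap.mem_range]
  rfl

/-- **The mod-`p` Satake isomorphism for `O_N(J₀)`, `N` odd, in characteristic `p = char 𝓀`.** [cite: Herzig2010, Thm. 1.2]
[cite: HenniartVigneras2013, Thm. 1.5 (ii)] -/
theorem mem_range_satakeTransform_one_iff_of_charP_orthogonal_odd (hd : UnramifiedLocalConjDatum (RingHom.id K) ϖ)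
    (hN : ¬ 2 ∣ N) (p : ℕ) [CharP 𝓀[K] p] [CharP R p] (f : AddMonoidAlgebra R (Fin N → ℤ)) :
    f ∈ ((hd.isIwasawaExponent (N := N)).satakeTransform (1 : Multiplicative (Fin N → ℤ) →* R)).range ↔
      ∀ μ : Fin N → ℤ, f.coeff μ ≠ 0 → Monotone μ ∧ ∀ i, μ (Fin.rev i) = -μ i :=
  hd.mem_range_satakeTransform_one_iff_of_cast_eq_zero_orthogonal_odd hN (natCast_card_residueField_eq_zero_of_charP p) f

end UnramifiedLocalConjDatum

end Literature.NumberTheory.Automorphic.HermitianLattice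

end
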